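import Literature.NumberTheory.Multiplicative.SmoothNumbersRankinTail
import HarnessLib

/-!
# Route `ChenParityOracleBLAP` — crux S1 = `HostParityFromBrick` (stmt-Parity-20045): the sifting identity for a rough variable

Support file for the prime half `K1 → K2 → HP1` of S1, sifting step (S).  Roughness of a summation
variable `t` (no prime factor `< N`, i.e. `t` coprime to the primorial `(N−1)#`) is expanded by
Möbius inversion over the divisors of `(N−1)#` (`sum_rough_eq_sum_moebius`):
`∑_{t ≤ T, (t,(N−1)#)=1} g(t) = ∑_{e ∣ (N−1)#} μ(e) ∑_{s ≤ T/e} g(es)`,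
and the divisors `e ≥ Y` are truncated at the cost of the integers with a large `N`-smooth divisor
(`abs_sum_rough_sub_truncated_le`):
`|∑_{t ≤ T rough} g(t) − ∑_{e ∣ (N−1)#, e < Y} μ(e) ∑_{s ≤ T/e} g(es)| ≤ ∑_{t ≤ T, ∃ e ∣ t N-smooth, e ≥ Y} τ(t) |g(t)|`.
Also `coprime_primorial_iff` (coprime to `(N−1)#` iff all prime factors are `≥ N`).

References: H. Iwaniec, E. Kowalski, *Analytic Number Theory* (2004), §6.2 (Legendre's formula)
[IwaniecKowalski2004].
-/

namespace Summit.Parity.GeneralizedHardyLittlewood.Theorems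

open Finset Real
open ArithmeticFunction (moebius)

/-- For `t ≠ 0`: `t` is coprime to `(N−1)#` iff every prime factor of `t` is `≥ N`. -/
theorem coprime_primorial_iff {N t : ℕ} (ht : t ≠ 0) :
    Nat.Coprime t (primorial (N - 1)) ↔ ∀ p ∈ t.primeFactors, N ≤ p := by
  constructor
  · intro h p hp
    have hpp : p.Prime := Nat.prime_of_mem_primeFactors hp
    have hpt : p ∣ t := Nat.dvd_of_mem_primeFactors hp
    by_contra hlt
    have hpP : p ∣ primorial (N - 1) := hpp.dvd_primorial_iff.2 (by omega)
    have h1 : p ∣ Nat.gcd t (primorial (N - 1)) := Nat.dvd_gcd hpt hpP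
    rw [Nat.Coprime.gcd_eq_one h] at h1
    exact hpp.one_lt.ne' (Nat.dvd_one.mp h1)
  · intro h
    rw [Nat.coprime_iff_gcd_eq_one]
    by_contra hne
    obtain ⟨p, hp, hpg⟩ := Nat.exists_prime_and_dvd hne
    have hpt : p ∣ t := hpg.trans (Nat.gcd_dvd_left _ _)
    have hpP : p ∣ primorial (N - 1) := hpg.trans (Nat.gcd_dvd_right _ _)
    have h1 : p ≤ N - 1 := hp.dvd_primorial_iff.1 hpP
    have h2 : N ≤ p := h p (Nat.mem_primeFactors.2 ⟨hp, hpt, ht⟩)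
    have := hp.two_le
    omega

/-- `∑_{e ∣ n} μ(e) = [n = 1]` (real-valued). -/
theorem sum_divisors_moebius_real (n : ℕ) :
    ∑ e ∈ n.divisors, (moebius e : ℝ) = if n = 1 then 1 else 0 := by
  have h := congrArg (fun f : ArithmeticFunction ℝ => f n)
    (ArithmeticFunction.coe_moebius_mul_coe_zeta (R := ℝ))
  simp only [ArithmeticFunction.coe_mul_zeta_apply, ArithmeticFunction.one_apply,
    ArithmeticFunction.intCoe_apply] at h
  exact h

/-- **Legendre / Möbius expansion of roughness.**  For `N ≥ 1`, `T`, and any `g`: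
`∑_{t ≤ T, (t,(N−1)#)=1} g(t) = ∑_{e ∣ (N−1)#} μ(e) ∑_{s ≤ T/e} g(es)`
[cite: IwaniecKowalski2004, Section 6.2]. -/
theorem sum_rough_eq_sum_moebius (N T : ℕ) (g : ℕ → ℝ) :
    ∑ t ∈ (Icc 1 T).filter (fun t => Nat.Coprime t (primorial (N - 1))), g t =
      ∑ e ∈ (primorial (N - 1)).divisors, (moebius e : ℝ) * ∑ s ∈ Icc 1 (T / e), g (e * s) := by
  classical
  set P := primorial (N - 1) with hP
  have hP0 : P ≠ 0 := primorial_ne_zero _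
  -- inner sums as sums over multiples of `e` in `[1,T]`
  have hinner : ∀ e ∈ P.divisors, ∑ s ∈ Icc 1 (T / e), g (e * s) =
      ∑ t ∈ (Icc 1 T).filter (fun t => e ∣ t), g t := by
    intro e he
    have he0 : 0 < e := Nat.pos_of_mem_divisors he
    refine Finset.sum_nbij' (fun s => e * s) (fun t => t / e) ?_ ?_ ?_ ?_ ?_
    · intro s hs
      rw [Finset.mem_Icc] at hs
      rw [Finset.mem_filter, Finset.mem_Icc]
      refine ⟨⟨Nat.le_mul_of_pos_right e hs.1 |>.trans' he0, ?_⟩, dvd_mul_right e s⟩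
      exact (Nat.mul_le_mul_left e hs.2).trans (Nat.mul_div_le T e)
    · intro t ht
      rw [Finset.mem_filter, Finset.mem_Icc] at ht
      rw [Finset.mem_Icc]
      obtain ⟨⟨ht1, htT⟩, k, hk⟩ := ht
      refine ⟨?_, Nat.div_le_div_right htT⟩
      rw [hk, Nat.mul_div_cancel_left k he0]
      rcases Nat.eq_zero_or_pos k with rfl | hk0
      · omega
      · exact hk0
    · intro s _; exact Nat.mul_div_cancel_left s he0
    · intro t ht
      rw [Finset.mem_filter] at ht
      obtain ⟨k, hk⟩ := ht.2
      rw [hk, Nat.mul_div_cancel_left k he0]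
    · intro s _; rfl
  rw [Finset.sum_congr rfl (fun e he => by rw [hinner e he] :
    ∀ e ∈ P.divisors, (moebius e : ℝ) * ∑ s ∈ Icc 1 (T / e), g (e * s) =
      (moebius e : ℝ) * ∑ t ∈ (Icc 1 T).filter (fun t => e ∣ t), g t)]
  -- swap: `∑_e μ(e) ∑_{t, e ∣ t} g t = ∑_t g t ∑_{e ∣ P, e ∣ t} μ(e)`
  have hswap : ∑ e ∈ P.divisors, (moebius e : ℝ) * ∑ t ∈ (Icc 1 T).filter (fun t => e ∣ t), g t =
      ∑ t ∈ Icc 1 T, g t * ∑ e ∈ P.divisors.filter (fun e => e ∣ t), (moebius e : ℝ) := by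
    have h1 : ∀ e, (moebius e : ℝ) * ∑ t ∈ (Icc 1 T).filter (fun t => e ∣ t), g t =
        ∑ t ∈ Icc 1 T, (if e ∣ t then (moebius e : ℝ) * g t else 0) := by
      intro e
      rw [Finset.sum_filter, Finset.mul_sum]
      refine Finset.sum_congr rfl fun t _ => ?_
      split_ifs <;> simp
    rw [Finset.sum_congr rfl (fun e _ => h1 e), Finset.sum_comm]
    refine Finset.sum_congr rfl fun t _ => ?_
    rw [Finset.sum_filter, Finset.mul_sum]
    refine Finset.sum_congr rfl fun e _ => ?_
    split_ifs <;> ring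
  rw [hswap, Finset.sum_filter]
  refine Finset.sum_congr rfl fun t ht => ?_
  rw [Finset.mem_Icc] at ht
  have ht0 : t ≠ 0 := by omega
  -- `{e ∣ P : e ∣ t} = divisors (gcd t P)`
  have hset : P.divisors.filter (fun e => e ∣ t) = (Nat.gcd t P).divisors := by
    ext e
    rw [Finset.mem_filter, Nat.mem_divisors, Nat.mem_divisors]
    constructor
    · rintro ⟨⟨heP, -⟩, het⟩
      exact ⟨Nat.dvd_gcd het heP, Nat.gcd_ne_zero_left ht0⟩  -- hmm
    · rintro ⟨he, -⟩
      exact ⟨⟨he.trans (Nat.gcd_dvd_right _ _), hP0⟩, he.trans (Nat.gcd_dvd_left _ _)⟩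
  rw [hset, sum_divisors_moebius_real]
  by_cases hc : Nat.Coprime t P
  · rw [if_pos hc, if_pos (Nat.coprime_iff_gcd_eq_one.mp hc), mul_one]
  · rw [if_neg hc, if_neg (fun h => hc (Nat.coprime_iff_gcd_eq_one.mpr h)), mul_zero]

/-- **Truncating the sifting identity.**  For `N ≥ 1`, `T`, `Y` and any `g`:
`|∑_{t ≤ T rough} g(t) − ∑_{e ∣ (N−1)#, e < Y} μ(e) ∑_{s ≤ T/e} g(es)| ≤ ∑_{t ≤ T : ∃ e ∣ t, e N-smooth, Y ≤ e} τ(t) |g(t)|`. -/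
theorem abs_sum_rough_sub_truncated_le (N T : ℕ) (Y : ℝ) (g : ℕ → ℝ) :
    |∑ t ∈ (Icc 1 T).filter (fun t => Nat.Coprime t (primorial (N - 1))), g t -
      ∑ e ∈ (primorial (N - 1)).divisors.filter (fun e : ℕ => (e : ℝ) < Y),
        (moebius e : ℝ) * ∑ s ∈ Icc 1 (T / e), g (e * s)| ≤
      ∑ t ∈ (Icc 1 T).filter (fun t => ∃ e ∈ t.divisors, e ∈ Nat.smoothNumbers N ∧ Y ≤ (e : ℝ)),
        (t.divisors.card : ℝ) * |g t| := by
  classical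
  set P := primorial (N - 1) with hP
  have hP0 : P ≠ 0 := primorial_ne_zero _
  rw [sum_rough_eq_sum_moebius, ← Finset.sum_filter_add_sum_filter_not P.divisors (fun e : ℕ => (e : ℝ) < Y),
    add_sub_cancel_left]
  -- the tail: `|∑_{e ∣ P, Y ≤ e} μ(e) ∑_{s ≤ T/e} g(es)| ≤ ∑_{e ∣ P, Y ≤ e} ∑_{t ≤ T, e ∣ t} |g t|`
  have hinner : ∀ e ∈ P.divisors, |∑ s ∈ Icc 1 (T / e), g (e * s)| ≤
      ∑ t ∈ (Icc 1 T).filter (fun t => e ∣ t), |g t| := by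
    intro e he
    have he0 : 0 < e := Nat.pos_of_mem_divisors he
    refine (Finset.abs_sum_le_sum_abs _ _).trans (le_of_eq ?_)
    refine Finset.sum_nbij' (fun s => e * s) (fun t => t / e) ?_ ?_ ?_ ?_ ?_
    · intro s hs
      rw [Finset.mem_Icc] at hs
      rw [Finset.mem_filter, Finset.mem_Icc]
      refine ⟨⟨Nat.le_mul_of_pos_right e hs.1 |>.trans' he0, ?_⟩, dvd_mul_right e s⟩
      exact (Nat.mul_le_mul_left e hs.2).trans (Nat.mul_div_le T e)
    · intro t ht
      rw [Finset.mem_filter, Finset.mem_Icc] at ht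
      rw [Finset.mem_Icc]
      obtain ⟨⟨ht1, htT⟩, k, hk⟩ := ht
      refine ⟨?_, Nat.div_le_div_right htT⟩
      rw [hk, Nat.mul_div_cancel_left k he0]
      rcases Nat.eq_zero_or_pos k with rfl | hk0
      · omega
      · exact hk0
    · intro s _; exact Nat.mul_div_cancel_left s he0
    · intro t ht
      rw [Finset.mem_filter] at ht
      obtain ⟨k, hk⟩ := ht.2
      rw [hk, Nat.mul_div_cancel_left k he0]
    · intro s _; rfl
  calc |∑ e ∈ P.divisors.filter (fun e : ℕ => ¬ (e : ℝ) < Y),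
        (moebius e : ℝ) * ∑ s ∈ Icc 1 (T / e), g (e * s)|
      ≤ ∑ e ∈ P.divisors.filter (fun e : ℕ => ¬ (e : ℝ) < Y),
          |(moebius e : ℝ) * ∑ s ∈ Icc 1 (T / e), g (e * s)| := Finset.abs_sum_le_sum_abs _ _
    _ ≤ ∑ e ∈ P.divisors.filter (fun e : ℕ => ¬ (e : ℝ) < Y),
          ∑ t ∈ (Icc 1 T).filter (fun t => e ∣ t), |g t| := by
        refine Finset.sum_le_sum fun e he => ?_
        rw [Finset.mem_filter] at he
        rw [abs_mul]
        have hmu : |(moebius e : ℝ)| ≤ 1 := by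
          have := ArithmeticFunction.abs_moebius_le_one (n := e)
          exact_mod_cast this
        calc |(moebius e : ℝ)| * |∑ s ∈ Icc 1 (T / e), g (e * s)|
            ≤ 1 * ∑ t ∈ (Icc 1 T).filter (fun t => e ∣ t), |g t| :=
              mul_le_mul hmu (hinner e he.1) (abs_nonneg _) zero_le_one
          _ = _ := one_mul _
    _ = ∑ t ∈ Icc 1 T, ∑ e ∈ (P.divisors.filter (fun e : ℕ => ¬ (e : ℝ) < Y)).filter (fun e => e ∣ t),
          |g t| := by
        rw [Finset.sum_comm']
        intro e t
        simp only [Finset.mem_filter, Finset.mem_Icc]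
        tauto
    _ = ∑ t ∈ Icc 1 T, (#((P.divisors.filter (fun e : ℕ => ¬ (e : ℝ) < Y)).filter (fun e => e ∣ t)) : ℝ) *
          |g t| := by
        refine Finset.sum_congr rfl fun t _ => ?_
        rw [Finset.sum_const, nsmul_eq_mul]
    _ ≤ _ := by
        rw [← Finset.sum_filter_add_sum_filter_not (Icc 1 T)
          (fun t => ∃ e ∈ t.divisors, e ∈ Nat.smoothNumbers N ∧ Y ≤ (e : ℝ))]
        have hzero : ∑ t ∈ (Icc 1 T).filter
            (fun t => ¬ ∃ e ∈ t.divisors, e ∈ Nat.smoothNumbers N ∧ Y ≤ (e : ℝ)),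
            (#((P.divisors.filter (fun e : ℕ => ¬ (e : ℝ) < Y)).filter (fun e => e ∣ t)) : ℝ) * |g t| = 0 := by
          refine Finset.sum_eq_zero fun t ht => ?_
          rw [Finset.mem_filter, Finset.mem_Icc] at ht
          have hempty : (P.divisors.filter (fun e : ℕ => ¬ (e : ℝ) < Y)).filter (fun e => e ∣ t) = ∅ := by
            rw [Finset.filter_eq_empty_iff]
            intro e he het
            rw [Finset.mem_filter, Nat.mem_divisors] at he
            apply ht.2
            refine ⟨e, Nat.mem_divisors.2 ⟨het, by omega⟩, ?_, le_of_not_gt he.2⟩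
            -- `e ∣ (N-1)#` is `N`-smooth
            rw [Nat.mem_smoothNumbers']
            intro p hp hpe
            have := hp.dvd_primorial_iff.1 (hpe.trans he.1.1)
            have := hp.two_le
            omega
          rw [hempty, Finset.card_empty, Nat.cast_zero, zero_mul]
        rw [hzero, add_zero]
        refine Finset.sum_le_sum fun t ht => ?_
        rw [Finset.mem_filter, Finset.mem_Icc] at ht
        refine mul_le_mul_of_nonneg_right ?_ (abs_nonneg _)
        have : #((P.divisors.filter (fun e : ℕ => ¬ (e : ℝ) < Y)).filter (fun e => e ∣ t)) ≤ #t.divisors := by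
          refine Finset.card_le_card fun e he => ?_
          rw [Finset.mem_filter] at he
          exact Nat.mem_divisors.2 ⟨he.2, by omega⟩
        exact_mod_cast this

end Summit.Parity.GeneralizedHardyLittlewood.Theorems
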